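import Summits.AtomisticToContinuum.FouriersLaw.Theorems.EmbeddedDrudeMourreMourreDissolutionGibbsMixing
import Literature.MathematicalPhysics.KineticTheory.TransportRegularityOfMixing
import Literature.MathematicalPhysics.KineticTheory.InfiniteChainClusteringTransfer
import Literature.MathematicalPhysics.KineticTheory.InfiniteChainL2Locality
import Literature.MathematicalPhysics.KineticTheory.InfiniteChainGeneratorLipschitz
import Literature.MathematicalPhysics.KineticTheory.InfiniteChainTwoPointContinuity
import Literature.MathematicalPhysics.KineticTheory.InfiniteChainSeveredGibbs
import Literature.MathematicalPhysics.KineticTheory.InfiniteChainGibbsInvariance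
import Literature.MathematicalPhysics.KineticTheory.InfiniteChainShiftInvariantUniqueness
import Literature.MathematicalPhysics.KineticTheory.InfiniteChainPartialMomentumReversal
import Literature.MathematicalPhysics.KineticTheory.InfiniteChainCurrentMoments
import HarnessLib

/-!
# Registered stub `stub_canonicalClusteringMajorant` of line `canonical-rigidity` — PROVED
# (crux `HeatVarianceCalculus`, item stmt-AtomisticToContinuum-15772, route CageBudgetFekete; `--supports`)

Target `Summits/AtomisticToContinuum/FouriersLaw/Theorems/CageBudgetFeketeHeatVarianceCalculusCanonicalMajorant.lean`.
The theorem name and signature are the REGISTERED stub's (skeleton `Cruxes/HeatVarianceCalculus/Lines/canonical_rigidity.lean`),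
verbatim. With it the line `canonical-rigidity` leaves exactly one open stub, the pure real-analysis
`stub_laplaceHeatVariance` (shared verbatim with the birth line).

The hardest stub of the line, PROVED from tree theorems only —
(M) the shift-invariant DLR state is the transfer-operator state
(`eq_of_isChainGibbsMeasure_of_isShiftInvariant_pinnedChain`), which is exponentially ρ-mixing between
half-lines (`Theorems.MourreDissolution.exists_gibbsState_mixing_pinnedChain`); (L) fixed-time `L²`-locality of
`j₀ ∘ φ_t` with a summable rate UNIFORM on `|t| ≤ τ` (`InfiniteChainDynamics.exists_summable_l2_locality`);
(T) the uniform-window clustering majorant `InfiniteChainDynamics.exists_summable_majorant_cov_flow`;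
`Cov = ∫ j₀ (j_x ∘ φ_t)` by `IsChainGibbsMeasure.integral_bondCurrentZ_eq_zero`, `bondCurrentZ_chainShift`
and the everywhere commutation `flow_chainShift_of_eq_id`. Signature verbatim the registered stub.
-/

noncomputable section

namespace Summit.AtomisticToContinuum.FouriersLaw.Theorems.HeatVarianceCalculus.CanonicalRigidity

open MeasureTheory ProbabilityTheory Filter Set Function
open Literature.MathematicalPhysics.KineticTheory.HeatConduction
open scoped Topology

/-- **Stub 1 of line `canonical-rigidity`, proved**: locally-uniform-in-time summable clustering of the
current pair correlations for the canonical Buttà–Marchioro dynamics of the pinned chain in its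
shift-invariant DLR state. [folklore] -/
theorem stub_canonicalClusteringMajorant :
    ∀ ω₂ lam β γ : ℝ, 0 < ω₂ → 0 < lam → 0 < β → ∀ T : ℝ, 0 < T →
    ∀ μ : MeasureTheory.Measure Literature.MathematicalPhysics.KineticTheory.HeatConduction.ChainConfig,
    (Literature.MathematicalPhysics.KineticTheory.HeatConduction.pinnedChain ω₂ lam β γ).IsChainGibbsMeasure T μ →
    Literature.MathematicalPhysics.KineticTheory.HeatConduction.IsShiftInvariant μ →
    μ.map (fun σ : Literature.MathematicalPhysics.KineticTheory.HeatConduction.ChainConfig => fun x : ℤ => ((σ x).1, -(σ x).2)) = μ →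
    ∀ D : Literature.MathematicalPhysics.KineticTheory.HeatConduction.InfiniteChainDynamics (Literature.MathematicalPhysics.KineticTheory.HeatConduction.pinnedChain ω₂ lam β γ),
    D.carrier = (Literature.MathematicalPhysics.KineticTheory.HeatConduction.pinnedChain ω₂ lam β γ).bmGood →
    (∀ t : ℝ, Measurable (D.flow t)) →
    (∀ t : ℝ, ∀ σ ∉ (Literature.MathematicalPhysics.KineticTheory.HeatConduction.pinnedChain ω₂ lam β γ).bmGood, D.flow t σ = σ) →
    ∀ τ : ℝ, ∃ m : ℤ → ℝ, Summable m ∧ ∀ t : ℝ, |t| ≤ τ → ∀ x : ℤ,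
      |∫ σ, (Literature.MathematicalPhysics.KineticTheory.HeatConduction.pinnedChain ω₂ lam β γ).bondCurrentZ σ 0 *
          (Literature.MathematicalPhysics.KineticTheory.HeatConduction.pinnedChain ω₂ lam β γ).bondCurrentZ (D.flow t σ) x ∂μ| ≤ m x := by
  intro ω₂ lam β γ hω hl hβ T hT μ hG hSI _hRefl D hcar hmeas hid τ
  -- the chain data: `U`, `V` even non-negative quartic polynomials, `C²`, condition B1
  have hU1 : OscillatorChain.IsEvenPolyOfDegree (pinnedChain ω₂ lam β γ).U 2 :=
    OscillatorChain.pinnedChain_isEvenPolyOfDegree_U β γ hω.le hl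
  have hV1 : OscillatorChain.IsEvenPolyOfDegree (pinnedChain ω₂ lam β γ).V 2 :=
    OscillatorChain.pinnedChain_isEvenPolyOfDegree_V ω₂ lam γ hβ
  have hU0 : ∀ r, 0 ≤ (pinnedChain ω₂ lam β γ).U r :=
    OscillatorChain.pinnedChain_U_nonneg β γ hω.le hl.le
  have hV0 : ∀ r, 0 ≤ (pinnedChain ω₂ lam β γ).V r := hV1.choose_spec.2.2
  have hU : ContDiff ℝ 2 (pinnedChain ω₂ lam β γ).U := hU1.contDiff_two
  have hV : ContDiff ℝ 2 (pinnedChain ω₂ lam β γ).V := hV1.contDiff_two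
  have hUm : Measurable (pinnedChain ω₂ lam β γ).U := hU.continuous.measurable
  have hB1 : (pinnedChain ω₂ lam β γ).CondB1 :=
    OscillatorChain.condB1_of_bddBelow _ hU hV ⟨0, by rintro _ ⟨q, rfl⟩; exact hU0 q⟩
      ⟨0, by rintro _ ⟨r, rfl⟩; exact hV0 r⟩
  -- (M): the given shift-invariant DLR state IS the mixing transfer-operator state (uniqueness)
  obtain ⟨μ', hG', hS', hss', -, C, m, hm, hmix⟩ :=
    Summit.AtomisticToContinuum.FouriersLaw.Theorems.MourreDissolution.exists_gibbsState_mixing_pinnedChain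
      ω₂ lam β γ hω hl.le hβ.le T hT
  have hμμ' : μ = μ' :=
    OscillatorChain.eq_of_isChainGibbsMeasure_of_isShiftInvariant_pinnedChain γ hω hl.le hβ.le hT hG hSI hG' hS'
  subst hμμ'
  have hss : (pinnedChain ω₂ lam β γ).HasSuperstabilityEstimate μ := hss'
  haveI : IsProbabilityMeasure μ := hss.1
  -- `μ` is invariant under the flow of `D` and under the severed box flows; translations preserve `μ`
  have hD : D.PreservesMeasure μ :=
    OscillatorChain.preservesMeasure_of_carrier_eq_bmGood (by norm_num) (by norm_num) hU1 hV1 D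
      hcar hmeas hG hss
  have hsev : ∀ (n : ℕ) (t : ℝ), MeasurePreserving
      (OscillatorChain.severedFlow hB1 (Finset.Icc ((0 : ℤ) - n) ((0 : ℤ) + n)) t) μ μ := fun n t =>
    OscillatorChain.measurePreserving_severedFlow_of_isChainGibbsMeasure hU hV hB1 _ hG t
  have hτ : ∀ x : ℤ, MeasurePreserving (chainShift x) μ μ := hSI.measurePreserving_chainShift
  -- the flow commutes with the translations everywhere
  have hφ : ∀ (t : ℝ) (x : ℤ), D.flow t ∘ chainShift x = chainShift x ∘ D.flow t := fun t x =>
    funext fun σ => D.flow_chainShift_of_eq_id hcar hid hU0 hV0 t x σ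
  -- the mixing constant may be taken non-negative
  have hmix' : ∀ (a : ℤ) (n : ℕ) (f g : ChainConfig → ℝ),
      DependsOn f {i : ℤ | i ≤ a} → DependsOn g {i : ℤ | a + n ≤ i} → Measurable f → Measurable g →
      MemLp f 2 μ → MemLp g 2 μ →
      |∫ σ, f σ * g σ ∂μ - (∫ σ, f σ ∂μ) * ∫ σ, g σ ∂μ| ≤
        max C 0 * Real.exp (-(m * n)) * (∫ σ, f σ ^ 2 ∂μ) ^ (1 / 2 : ℝ) *
          (∫ σ, g σ ^ 2 ∂μ) ^ (1 / 2 : ℝ) := by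
    intro a n f g h1 h2 h3 h4 h5 h6
    refine (hmix a n f g h1 h2 h3 h4 h5 h6).trans ?_
    have hA : 0 ≤ (∫ σ, f σ ^ 2 ∂μ) ^ (1 / 2 : ℝ) :=
      Real.rpow_nonneg (integral_nonneg fun _ => sq_nonneg _) _
    have hB : 0 ≤ (∫ σ, g σ ^ 2 ∂μ) ^ (1 / 2 : ℝ) :=
      Real.rpow_nonneg (integral_nonneg fun _ => sq_nonneg _) _
    have hE : 0 ≤ Real.exp (-(m * n)) := Real.exp_nonneg _
    have : C * Real.exp (-(m * n)) ≤ max C 0 * Real.exp (-(m * n)) :=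
      mul_le_mul_of_nonneg_right (le_max_left _ _) hE
    exact mul_le_mul_of_nonneg_right (mul_le_mul_of_nonneg_right this hA) hB
  have hC : 0 ≤ max C 0 := le_max_right _ _
  -- the generator `a = j₀`: measurable, local, in `L²` and `L⁴`, polynomially Lipschitz
  set a : ChainConfig → ℝ := fun σ => (pinnedChain ω₂ lam β γ).bondCurrentZ σ 0 with ha_def
  have ham : Measurable a := measurable_bondCurrentZ _ 0
  have had : DependsOn a (Icc (-1 : ℤ) 1) := OscillatorChain.dependsOn_bondCurrentZ_zero _
  have ha2 : MemLp a 2 μ := hss.memLp_bondCurrentZ (by norm_num) hU0 hUm hV1 0 ENNReal.ofNat_ne_top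
  have ha4' : MemLp a 4 μ := hss.memLp_bondCurrentZ (by norm_num) hU0 hUm hV1 0 ENNReal.ofNat_ne_top
  have ha4 : Integrable (fun σ => a σ ^ 4) μ := by
    have h := ha4'.integrable_norm_pow' (p := 4)
    refine h.congr (Eventually.of_forall fun σ => ?_)
    simp only [Real.norm_eq_abs]
    exact Even.pow_abs (by decide) _
  obtain ⟨Ca, hCa, hL⟩ := OscillatorChain.exists_polyLipschitz_bondCurrentZ hV1
  -- (L): `L²`-locality of `a ∘ φ_t`, uniformly on the window `|t| ≤ max τ 0`, summable rate
  have hloc : ∃ ε : ℕ → ℝ, (∀ n, 0 ≤ ε n) ∧ Summable ε ∧ ∀ t : ℝ, |t| ≤ max τ 0 → ∀ n : ℕ,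
      ∃ g : ChainConfig → ℝ, DependsOn g (Icc (-(n : ℤ) - 1) (n + 1)) ∧ Measurable g ∧
        MemLp g 2 μ ∧ Real.sqrt (∫ σ, (a (D.flow t σ) - g σ) ^ 2 ∂μ) ≤ ε n := by
    obtain ⟨ε, hε0, hε, hmain⟩ := D.exists_summable_l2_locality (by norm_num) (by norm_num) hU1 hV1
      hcar hB1 hss hD hsev ham had ha2 ha4 hCa hL (max τ 0) (le_max_right _ _)
    refine ⟨ε, hε0, hε, fun t ht n => ?_⟩
    obtain ⟨h1, h2, h3, h4⟩ := hmain t ht n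
    exact ⟨_, h1, h2, h3, h4⟩
  -- (T): ONE summable majorant of `|Cov(a, (a ∘ φ_t) ∘ τ_x)|` for all `|t| ≤ max τ 0`
  obtain ⟨F, hF, hb⟩ := D.exists_summable_majorant_cov_flow hτ hD hC hm hmix' ham had ha2 hloc
  -- mean zero of the current in a DLR state
  have hmean : ∫ σ, a σ ∂μ = 0 := hG.integral_bondCurrentZ_eq_zero 0
  refine ⟨F, hF, fun t ht x => ?_⟩
  have ht' : |t| ≤ max τ 0 := ht.trans (le_max_left _ _)
  have hY2 : MemLp ((a ∘ D.flow t) ∘ chainShift x) 2 μ :=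
    (ha2.comp_measurePreserving (hD.2 t)).comp_measurePreserving (hτ x)
  have hcov : cov[a, (a ∘ D.flow t) ∘ chainShift x; μ] =
      ∫ σ, (pinnedChain ω₂ lam β γ).bondCurrentZ σ 0 *
        (pinnedChain ω₂ lam β γ).bondCurrentZ (D.flow t σ) x ∂μ := by
    rw [covariance_eq_sub ha2 hY2, hmean, zero_mul, sub_zero]
    refine integral_congr_ae (Eventually.of_forall fun σ => ?_)
    simp only [Pi.mul_apply, comp_apply, ha_def]
    rw [show D.flow t (chainShift x σ) = chainShift x (D.flow t σ) from congrFun (hφ t x) σ,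
      OscillatorChain.bondCurrentZ_chainShift, zero_add]
  rw [← hcov]
  exact hb t ht' x

end Summit.AtomisticToContinuum.FouriersLaw.Theorems.HeatVarianceCalculus.CanonicalRigidity

end
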